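import Summits.AtomisticToContinuum.BoseEinsteinCondensation.Theorems.BECHeatBathGapSomeNearMinimiserCondenses
import Literature.MathematicalPhysics.QuantumManyBody.GroundState
import Literature.MathematicalPhysics.QuantumManyBody.OneParticleMarginals
import Literature.MathematicalPhysics.QuantumManyBody.SwapPurity
import Mathlib.MeasureTheory.Group.LIntegral
import HarnessLib

/-!
# Route `BECHeatBathGap`, crux `SquareSummableInfluence` (stmt-AtomisticToContinuum-14368),
# line `registered`: the rung `pairProductInsertion_influence_le`

Supports (does not close) stmt-AtomisticToContinuum-14368; rung `pairProductInsertion_influence_le`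
of line `registered` (skeleton v3): the pair-product insertion MODEL of the physics stub
("PairInfluenceReduction").

**The influence of one bath particle on a pair-product insertion state.** The crux A2 asks that the
`(N+1)`-body ground state be predictable from the `N`-body one particle by particle, by bounded
measurable predictors `g_i(Z)` blind to the bath particle `x_i = Z (succ i)`, with small total
squared influence `∑_i ∫_{Λ^{N+1}} |Ψ₀(Z) − g_i(Z) Θ₀(tail Z)|²` (`Z 0` is the inserted particle,
`tail Z` the `N` bath particles). This file computes that influence for the
Bijl–Dingle–Jastrow / Dyson–Lieb–Yngvason insertion trial state built over ANY bath amplitude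
`Θ : Λ^N → ℂ` with ANY pair factor `0 ≤ f ≤ 1` on `ℝ³`,

`Ψ(Z) = Θ(tail Z) ∏_j f(Z 0 − Z (succ j))`

(the trial states of [Dyson1957], [LiebYngvason1998], [LSSY2005] §2.1 insert one particle into the
bath this way). The predictor DROPPING the `i`-th pair factor,

`g_i(Z) = ∏_{j ≠ i} f(Z 0 − Z (succ j))`,

is measurable, bounded by `1`, blind to `x_i`, and

`∑_i ∫_{Λ_L^{N+1}} |Ψ(Z) − g_i(Z) Θ(tail Z)|² dZ ≤ N · ∫_{ℝ³} (1 − f)² · ∫_{Λ_L^N} |Θ|²`: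

the influence of an insertion state is `O(ρ ∫ (1 − f)²)` per unit `‖Θ‖²`, finite iff the pair
deficit `1 − f` is square integrable (the dressed-tail criterion behind A2).

## Proof

Pointwise, `∏_j f_j = f_i ∏_{j ≠ i} f_j` (`Finset.mul_prod_erase`), so
`Ψ − g_i Θ(tail) = Θ(tail Z) g_i(Z) (f(Z 0 − Z (succ i)) − 1)` and, as `|g_i| ≤ 1`,
`|Ψ − g_i Θ(tail)|² ≤ |Θ(tail Z)|² (1 − f(Z 0 − Z (succ i)))²`
(`nnnorm_mul_prod_sub_prod_erase_mul_sq_le`). Tonelli over `Λ_L × Λ_L^N ≅ Λ_L^{N+1}`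
(`setLIntegral_box_boxN_vecCons`), enlarging the integral over the inserted particle from `Λ_L`
to `ℝ³`, swapping the two integrals (`lintegral_lintegral_swap`) and translation invariance of
Lebesgue measure (`∫ (1 − f(y − x_i))² dy = ∫ (1 − f)²`, `lintegral_sub_right_eq_self`) bound each
term by `∫ (1 − f)² · ∫_{Λ_L^N} |Θ|²` (`setLIntegral_tail_sq_mul_deficit_le`); summing the `N`
terms gives the claim.

No new definitions; `[folklore]`.
-/

noncomputable section

open MeasureTheory Filter
open scoped ENNReal NNReal Topology

namespace Summit.AtomisticToContinuum.BoseEinsteinCondensation.Theorems.SquareSummableInfluence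

open Literature.MathematicalPhysics.QuantumManyBody.BoseGas

/-! ### Bookkeeping lemmas -/

/-- **The pointwise step**: dropping the `i`-th factor of a product of numbers `a_j ∈ [0, 1]`
costs `|θ ∏_j a_j − (∏_{j ≠ i} a_j) θ|² ≤ |θ|² (1 − a_i)²`
(`θ ∏_j a_j − (∏_{j ≠ i} a_j) θ = θ (∏_{j ≠ i} a_j) (a_i − 1)` and `|∏_{j ≠ i} a_j| ≤ 1`).
[folklore] -/
private theorem nnnorm_mul_prod_sub_prod_erase_mul_sq_le {N : ℕ} (θ : ℂ) (a : Fin N → ℝ)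
    (ha : ∀ j, 0 ≤ a j ∧ a j ≤ 1) (i : Fin N) :
    (‖θ * (∏ j, (a j : ℂ)) - (∏ j ∈ Finset.univ.erase i, (a j : ℂ)) * θ‖₊ : ℝ≥0∞) ^ 2 ≤
      (‖θ‖₊ : ℝ≥0∞) ^ 2 * ENNReal.ofReal ((1 - a i) ^ 2) := by
  set P : ℂ := ∏ j ∈ Finset.univ.erase i, (a j : ℂ) with hP
  have hP1 : ‖P‖ ≤ 1 := by
    rw [hP, Complex.norm_prod]
    exact Finset.prod_le_one (fun j _ => norm_nonneg _) fun j _ => by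
      rw [Complex.norm_of_nonneg (ha j).1]
      exact (ha j).2
  have hprod : ∏ j, (a j : ℂ) = (a i : ℂ) * P :=
    (Finset.mul_prod_erase Finset.univ (fun j => (a j : ℂ)) (Finset.mem_univ i)).symm
  rw [hprod, coe_nnnorm_sq_eq_ofReal, coe_nnnorm_sq_eq_ofReal, ← ENNReal.ofReal_mul (sq_nonneg _)]
  refine ENNReal.ofReal_le_ofReal ?_
  have e : θ * ((a i : ℂ) * P) - P * θ = θ * P * ((a i : ℂ) - 1) := by ring
  have hai : ‖(a i : ℂ) - 1‖ = 1 - a i := by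
    rw [← Complex.ofReal_one, ← Complex.ofReal_sub, Complex.norm_real, Real.norm_eq_abs,
      abs_sub_comm, abs_of_nonneg (by linarith [(ha i).2])]
  have h1 : ‖θ * ((a i : ℂ) * P) - P * θ‖ ≤ ‖θ‖ * (1 - a i) := by
    rw [e, norm_mul, norm_mul, hai]
    calc ‖θ‖ * ‖P‖ * (1 - a i) ≤ ‖θ‖ * 1 * (1 - a i) :=
          mul_le_mul_of_nonneg_right (mul_le_mul_of_nonneg_left hP1 (norm_nonneg _))
            (by linarith [(ha i).2])
      _ = ‖θ‖ * (1 - a i) := by ring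
  calc ‖θ * ((a i : ℂ) * P) - P * θ‖ ^ 2 ≤ (‖θ‖ * (1 - a i)) ^ 2 :=
        pow_le_pow_left₀ (norm_nonneg _) h1 2
    _ = ‖θ‖ ^ 2 * (1 - a i) ^ 2 := by ring

/-- **The Tonelli step**: for measurable `f`, `Θ` and a bath label `i`,
`∫_{Λ_L^{N+1}} |Θ(tail Z)|² (1 − f(Z 0 − Z (succ i)))² dZ ≤ ∫_{ℝ³} (1 − f)² · ∫_{Λ_L^N} |Θ|²`
(Tonelli `Λ_L^{N+1} ≅ Λ_L × Λ_L^N`, `Λ_L ⊆ ℝ³`, Fubini swap, translation invariance of Lebesgue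
measure in the inserted coordinate). [folklore] -/
private theorem setLIntegral_tail_sq_mul_deficit_le (N : ℕ) (L : ℝ) (f : Space → ℝ)
    (Θ : Config N → ℂ) (hf : Measurable f) (hΘ : Measurable Θ) (i : Fin N) :
    ∫⁻ Z in boxN (N + 1) L, (‖Θ (Matrix.vecTail Z)‖₊ : ℝ≥0∞) ^ 2 *
        ENNReal.ofReal ((1 - f (Z 0 - Z (Fin.succ i))) ^ 2) ≤
      (∫⁻ x, ENNReal.ofReal ((1 - f x) ^ 2)) * ∫⁻ X in boxN N L, (‖Θ X‖₊ : ℝ≥0∞) ^ 2 := by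
  -- measurability bookkeeping: the deficit `D = (1 − f)²`, the bath density `T = |Θ|²`
  have hD : Measurable fun x : Space => ENNReal.ofReal ((1 - f x) ^ 2) :=
    ENNReal.measurable_ofReal.comp ((measurable_const.sub hf).pow_const 2)
  have hT : Measurable fun X : Config N => (‖Θ X‖₊ : ℝ≥0∞) ^ 2 :=
    hΘ.nnnorm.coe_nnreal_ennreal.pow_const 2
  have hG : Measurable fun Z : Config (N + 1) => (‖Θ (Matrix.vecTail Z)‖₊ : ℝ≥0∞) ^ 2 *
      ENNReal.ofReal ((1 - f (Z 0 - Z (Fin.succ i))) ^ 2) :=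
    (hT.comp measurable_vecTail).mul
      (hD.comp ((measurable_pi_apply 0).sub (measurable_pi_apply (Fin.succ i))))
  have hF : Measurable (Function.uncurry fun (y : Space) (X : Config N) =>
      (‖Θ X‖₊ : ℝ≥0∞) ^ 2 * ENNReal.ofReal ((1 - f (y - X i)) ^ 2)) :=
    (hT.comp measurable_snd).mul
      (hD.comp (measurable_fst.sub ((measurable_pi_apply i).comp measurable_snd)))
  calc ∫⁻ Z in boxN (N + 1) L, (‖Θ (Matrix.vecTail Z)‖₊ : ℝ≥0∞) ^ 2 *
          ENNReal.ofReal ((1 - f (Z 0 - Z (Fin.succ i))) ^ 2)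
      = ∫⁻ y in box L, ∫⁻ X in boxN N L,
          (‖Θ X‖₊ : ℝ≥0∞) ^ 2 * ENNReal.ofReal ((1 - f (y - X i)) ^ 2) := by
        rw [← setLIntegral_box_boxN_vecCons L hG]
        simp only [Matrix.tail_cons, Matrix.cons_val_zero, Matrix.cons_val_succ]
    _ ≤ ∫⁻ y, ∫⁻ X in boxN N L,
          (‖Θ X‖₊ : ℝ≥0∞) ^ 2 * ENNReal.ofReal ((1 - f (y - X i)) ^ 2) :=
        setLIntegral_le_lintegral _ _
    _ = ∫⁻ X in boxN N L, ∫⁻ y,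
          (‖Θ X‖₊ : ℝ≥0∞) ^ 2 * ENNReal.ofReal ((1 - f (y - X i)) ^ 2) :=
        lintegral_lintegral_swap hF.aemeasurable
    _ = ∫⁻ X in boxN N L, (‖Θ X‖₊ : ℝ≥0∞) ^ 2 * ∫⁻ x, ENNReal.ofReal ((1 - f x) ^ 2) := by
        refine lintegral_congr fun X => ?_
        have hDX : Measurable fun y : Space => ENNReal.ofReal ((1 - f (y - X i)) ^ 2) :=
          hD.comp (measurable_sub_const (X i))
        rw [lintegral_const_mul _ hDX,
          lintegral_sub_right_eq_self (fun y => ENNReal.ofReal ((1 - f y) ^ 2)) (X i)]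
    _ = (∫⁻ x, ENNReal.ofReal ((1 - f x) ^ 2)) * ∫⁻ X in boxN N L, (‖Θ X‖₊ : ℝ≥0∞) ^ 2 := by
        rw [lintegral_mul_const _ hT, mul_comm]

/-! ### The rung -/

/-- **Rung `pairProductInsertion_influence_le` of line `registered` of the crux
`SquareSummableInfluence`: the influence of one bath particle on a pair-product insertion state.**
For a measurable bath amplitude `Θ : Λ^N → ℂ` and a measurable pair factor `0 ≤ f ≤ 1`, the
predictors `g_i(Z) = ∏_{j ≠ i} f(Z 0 − Z (succ j))` (drop the `i`-th pair factor of the insertion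
state `Ψ(Z) = Θ(tail Z) ∏_j f(Z 0 − Z (succ j))`) are measurable, bounded by `1`, blind to the bath
particle `x_i = Z (succ i)`, and
`∑_i ∫_{Λ_L^{N+1}} |Ψ(Z) − g_i(Z) Θ(tail Z)|² ≤ N · ∫_{ℝ³} (1 − f)² · ∫_{Λ_L^N} |Θ|²`
(pointwise `|Ψ − g_i Θ(tail)|² ≤ |Θ(tail Z)|² (1 − f(Z 0 − x_i))²`, Tonelli `Λ^{N+1} ≅ Λ × Λ^N`,
`Λ ⊆ ℝ³`, translation invariance `∫ (1 − f(y − x_i))² dy = ∫ (1 − f)²`). [folklore] -/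
theorem pairProductInsertion_influence_le :
    ∀ (N : ℕ) (L : ℝ) (f : Space → ℝ) (Θ : Config N → ℂ), Measurable f → (∀ x, 0 ≤ f x ∧ f x ≤ 1) →
      Measurable Θ →
      ∃ g : Fin N → Config (N + 1) → ℂ,
        (∀ i, Measurable (g i)) ∧ (∀ i Z, ‖g i Z‖ ≤ 1) ∧
        (∀ i Z x, g i (Function.update Z (Fin.succ i) x) = g i Z) ∧
        (∑ i : Fin N, ∫⁻ Z in boxN (N + 1) L,
            (‖Θ (Matrix.vecTail Z) * (∏ j : Fin N, (f (Z 0 - Z (Fin.succ j)) : ℂ)) -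
                g i Z * Θ (Matrix.vecTail Z)‖₊ : ℝ≥0∞) ^ 2) ≤
          (N : ℝ≥0∞) * (∫⁻ x, ENNReal.ofReal ((1 - f x) ^ 2)) *
            ∫⁻ X in boxN N L, (‖Θ X‖₊ : ℝ≥0∞) ^ 2 := by
  intro N L f Θ hf hf01 hΘ
  -- the pair factors `Z ↦ f(Z 0 − Z (succ j))`, as complex numbers, are measurable and in `[0, 1]`
  have hφm : ∀ j : Fin N, Measurable fun Z : Config (N + 1) => (f (Z 0 - Z (Fin.succ j)) : ℂ) :=
    fun j => Complex.measurable_ofReal.comp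
      (hf.comp ((measurable_pi_apply 0).sub (measurable_pi_apply (Fin.succ j))))
  have hφ1 : ∀ (j : Fin N) (Z : Config (N + 1)), ‖(f (Z 0 - Z (Fin.succ j)) : ℂ)‖ ≤ 1 :=
    fun j Z => by
      rw [Complex.norm_of_nonneg (hf01 _).1]
      exact (hf01 _).2
  refine ⟨fun i Z => ∏ j ∈ Finset.univ.erase i, (f (Z 0 - Z (Fin.succ j)) : ℂ),
    fun i => Finset.measurable_prod _ fun j _ => hφm j,
    fun i Z => ?_, fun i Z x => ?_, ?_⟩
  · -- `|g_i| ≤ 1`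
    rw [Complex.norm_prod]
    exact Finset.prod_le_one (fun j _ => norm_nonneg _) fun j _ => hφ1 j Z
  · -- `g_i` is blind to `x_i = Z (succ i)`: it only reads `Z 0` and the `Z (succ j)`, `j ≠ i`
    refine Finset.prod_congr rfl fun j hj => ?_
    have hji : j ≠ i := (Finset.mem_erase.1 hj).1
    rw [Function.update_of_ne (Fin.succ_ne_zero i).symm,
      Function.update_of_ne ((Fin.succ_injective N).ne hji)]
  · -- the influence bound: pointwise step, Tonelli step, and the sum of `N` identical bounds
    calc (∑ i : Fin N, ∫⁻ Z in boxN (N + 1) L,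
            (‖Θ (Matrix.vecTail Z) * (∏ j : Fin N, (f (Z 0 - Z (Fin.succ j)) : ℂ)) -
                (∏ j ∈ Finset.univ.erase i, (f (Z 0 - Z (Fin.succ j)) : ℂ)) *
                  Θ (Matrix.vecTail Z)‖₊ : ℝ≥0∞) ^ 2)
        ≤ ∑ i : Fin N, ∫⁻ Z in boxN (N + 1) L, (‖Θ (Matrix.vecTail Z)‖₊ : ℝ≥0∞) ^ 2 *
            ENNReal.ofReal ((1 - f (Z 0 - Z (Fin.succ i))) ^ 2) :=
          Finset.sum_le_sum fun i _ => lintegral_mono fun Z =>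
            nnnorm_mul_prod_sub_prod_erase_mul_sq_le (Θ (Matrix.vecTail Z))
              (fun j => f (Z 0 - Z (Fin.succ j))) (fun j => hf01 _) i
      _ ≤ ∑ _i : Fin N, (∫⁻ x, ENNReal.ofReal ((1 - f x) ^ 2)) *
            ∫⁻ X in boxN N L, (‖Θ X‖₊ : ℝ≥0∞) ^ 2 :=
          Finset.sum_le_sum fun i _ => setLIntegral_tail_sq_mul_deficit_le N L f Θ hf hΘ i
      _ = (N : ℝ≥0∞) * (∫⁻ x, ENNReal.ofReal ((1 - f x) ^ 2)) *
            ∫⁻ X in boxN N L, (‖Θ X‖₊ : ℝ≥0∞) ^ 2 := by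
          rw [Finset.sum_const, Finset.card_univ, Fintype.card_fin, nsmul_eq_mul, mul_assoc]

end Summit.AtomisticToContinuum.BoseEinsteinCondensation.Theorems.SquareSummableInfluence

end
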